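import Literature.Analysis.Fourier.ExpAbsKernelPlancherel
import Literature.Analysis.SpecialFunctions.MatsubaraSum
import Literature.Analysis.SpecialFunctions.TanhPartialFractions
import Literature.MathematicalPhysics.QuantumLattice.DuhamelTwoPoint
import Mathlib
import HarnessLib

/-!
# Quantum belief propagation, part 4: the Hastings–CMTW weight `f_β`

Helper file (theorems only, model-free) for stub B (`stub_farCutCurrent_of_clustering`) of the line
`gauge_qbp_far_seam` (cruxes `TcThermcert1.ThermalStiffnessCeilingU8b8_le_7o44` / `…U8b10_le_1o8`,
route `hubbard-tc-thermcert-1`).  Parts 1–3 prove the QBP ODE and CMTW Prop. 6 (a) for ANY integrable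
real weight `f` with the kernel identity `f̂(y - x) (e^{-βx} + e^{-βy}) = 2 K_β(x, y)`
(`K_β = Matrix.duhamelKernel`).  This file supplies THE weight, the Matsubara series
`f_β(t) = Σ_{m ≥ 0} (4 / (β (2m+1) π)) e^{-(2m+1)π|t|/β}` (`= (2/(βπ)) log coth(π|t|/(2β))`), through
the hypothesis `hf : ∀ t, f t = Σ' m, …` (no definition; the line file instantiates `f`).  Proved: a
series of integrable functions with summable `L¹` norms is integrable; per-term facts for `e^{-a|t|}`
(`∫ = 2/a`, the Fourier pair `2a/(a² + ω²)` from `Literature.Analysis.Fourier`, the exact tail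
`2e^{-aT}/a`); `Σ 8/((2m+1)²π²) = 1` (Euler's odd-square sum from the tree); and for `f = f_β` (`β > 0`): `f ≥ 0`, `Integrable f`, `∫ f = 1`,
`∫ |f| = 1`, `∫ e^{itω} f(t) dt = 2 tanh(βω/2)/(βω)` (`ω ≠ 0`; `= 1` at `0`) from the fermionic
Matsubara sum of `Literature.Analysis.SpecialFunctions`, the KERNEL IDENTITY
`qbpWeight_kernel_identity` in exactly the form consumed by part 3, and `∫_{|t| > T} |f| ≤ e^{-πT/β}`.
[cite: CapelEtAl2023, §2.2 eq. (2.8) and Proposition 6; arXiv:2310.09182]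
-/

noncomputable section

open MeasureTheory Set Filter Complex
open scoped Real Topology ENNReal

namespace Summit.Ventures.CertifiedManyBodySolver.Theorems.TcThermcert1.GaugeQbpFarSeam

open Literature.Analysis.Fourier Literature.Analysis.SpecialFunctions
  Literature.MathematicalPhysics.QuantumLattice

/-! ## §1 Integrability of an `L¹`-summable series -/

/-- A series of integrable functions with `Σₙ ∫ ‖gₙ‖ < ∞` sums (pointwise `tsum`) to an integrable
function. [folklore] -/
theorem integrable_tsum_of_summable_integral_norm' {α : Type*} [MeasurableSpace α] {μ : Measure α}
    {E : Type*} [NormedAddCommGroup E] [NormedSpace ℝ E] [CompleteSpace E]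
    {g : ℕ → α → E} (hg : ∀ n, Integrable (g n) μ) (h : Summable fun n => ∫ a, ‖g n a‖ ∂μ) :
    Integrable (fun a => ∑' n, g n a) μ := by
  have hlin : ∑' n, ∫⁻ a, ‖g n a‖ₑ ∂μ ≠ ∞ := by
    have heq : ∀ n, ∫⁻ a, ‖g n a‖ₑ ∂μ = ENNReal.ofReal (∫ a, ‖g n a‖ ∂μ) := fun n =>
      (ofReal_integral_norm_eq_lintegral_enorm (hg n)).symm
    rw [tsum_congr heq, ← ENNReal.ofReal_tsum_of_nonneg (fun n => integral_nonneg fun a => norm_nonneg _) h]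
    exact ENNReal.ofReal_ne_top
  have hS : ∀ᵐ a ∂μ, Summable fun n => ‖g n a‖ := by
    refine summable_norm_of_tsum_eLpNorm_ne_top le_rfl (fun n => (hg n).1) ?_
    simpa only [eLpNorm_one_eq_lintegral_enorm] using hlin
  have hmeas : AEStronglyMeasurable (fun a => ∑' n, g n a) μ := by
    refine aestronglyMeasurable_of_tendsto_ae atTop
      (f := fun N a => ∑ n ∈ Finset.range N, g n a) (fun N => ?_) ?_
    · exact Finset.aestronglyMeasurable_fun_sum _ fun n _ => (hg n).1
    · filter_upwards [hS] with a ha using ha.of_norm.hasSum.tendsto_sum_nat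
  have hle : ∫⁻ a, ‖∑' n, g n a‖ₑ ∂μ ≤ ∑' n, ∫⁻ a, ‖g n a‖ₑ ∂μ :=
    calc ∫⁻ a, ‖∑' n, g n a‖ₑ ∂μ ≤ ∫⁻ a, ∑' n, ‖g n a‖ₑ ∂μ :=
          lintegral_mono fun a => enorm_tsum_le_tsum_enorm
      _ = ∑' n, ∫⁻ a, ‖g n a‖ₑ ∂μ := lintegral_tsum fun n => (hg n).1.enorm
  exact ⟨hmeas, lt_of_le_of_lt hle hlin.lt_top⟩

/-! ## §2 The two-sided exponential `e^{-a|t|}` -/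

/-- `t ↦ e^{-a|t|}` is integrable (`a > 0`). [folklore] -/
theorem integrable_exp_neg_mul_abs_real {a : ℝ} (ha : 0 < a) :
    Integrable fun t : ℝ => Real.exp (-(a * |t|)) := by
  refine (integrable_exp_neg_mul_abs ha).re.congr (Eventually.of_forall fun t => ?_)
  simp only [RCLike.re_to_complex, Complex.ofReal_re]

/-- The Fourier pair `∫ e^{itω} e^{-a|t|} dt = 2a/(a² + ω²)` (`a > 0`), in the orientation of this
port. [cite: Grafakos2014, Exercise 2.2.11 (b)] -/
theorem integral_cexp_mul_exp_neg_mul_abs {a : ℝ} (ha : 0 < a) (ω : ℝ) :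
    ∫ t : ℝ, cexp ((t : ℂ) * (ω : ℂ) * I) * (Real.exp (-(a * |t|)) : ℂ) =
      ((2 * a / (a ^ 2 + ω ^ 2) : ℝ) : ℂ) := by
  rw [← integral_exp_neg_mul_abs_mul_cexp ha ω]
  refine integral_congr_ae (Eventually.of_forall fun t => ?_)
  simp only
  rw [mul_comm]
  congr 2
  ring

/-- `∫ e^{-a|t|} dt = 2/a` (`a > 0`). [folklore] -/
theorem integral_exp_neg_mul_abs_real {a : ℝ} (ha : 0 < a) :
    ∫ t : ℝ, Real.exp (-(a * |t|)) = 2 / a := by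
  have h := integral_cexp_mul_exp_neg_mul_abs ha 0
  simp only [Complex.ofReal_zero, mul_zero, zero_mul, Complex.exp_zero, one_mul,
    integral_complex_ofReal] at h
  have h' := Complex.ofReal_injective h
  rw [h', sq (0 : ℝ), mul_zero, add_zero]
  field_simp

/-- The exact tail `∫_{|t| > T} e^{-a|t|} dt = 2e^{-aT}/a` (`a > 0`, `T ≥ 0`). [folklore] -/
theorem setIntegral_exp_neg_mul_abs_tail {a T : ℝ} (ha : 0 < a) (hT : 0 ≤ T) :
    ∫ t in {t : ℝ | T < |t|}, Real.exp (-(a * |t|)) = 2 * Real.exp (-(a * T)) / a := by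
  have hS : {t : ℝ | T < |t|} = Ioi T ∪ Iio (-T) := by
    ext t
    simp only [mem_setOf_eq, mem_union, mem_Ioi, mem_Iio, lt_abs, lt_neg]
  have hdisj : Disjoint (Ioi T) (Iio (-T)) := Set.disjoint_left.2 fun t (ht : T < t) (ht' : t < -T) => by
    linarith
  have hint := integrable_exp_neg_mul_abs_real ha
  rw [hS, setIntegral_union hdisj measurableSet_Iio hint.integrableOn hint.integrableOn]
  have h1 : ∫ t in Ioi T, Real.exp (-(a * |t|)) = Real.exp (-(a * T)) / a := by
    rw [setIntegral_congr_fun measurableSet_Ioi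
      (fun t (ht : T < t) => by rw [abs_of_pos (lt_of_le_of_lt hT ht), ← neg_mul])]
    rw [integral_exp_mul_Ioi (neg_neg_of_pos ha) T, neg_mul, neg_div_neg_eq]
  have h2 : ∫ t in Iio (-T), Real.exp (-(a * |t|)) = Real.exp (-(a * T)) / a := by
    rw [setIntegral_congr_set Iio_ae_eq_Iic, setIntegral_congr_fun measurableSet_Iic
      (fun t (ht : t ≤ -T) => by rw [abs_of_nonpos (by linarith), mul_neg, neg_neg])]
    rw [integral_exp_mul_Iic ha (-T), mul_neg]
  rw [h1, h2]
  ring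

/-! ## §3 `Σ 8/((2m+1)²π²) = 1` (from the tree's `Σ 1/(2m+1)² = π²/8`) -/

/-- `Σ_{m ≥ 0} 8/((2m+1)² π²) = 1`. [folklore] -/
theorem hasSum_qbpMass : HasSum (fun m : ℕ => 8 / ((2 * (m : ℝ) + 1) ^ 2 * π ^ 2)) 1 := by
  have hπ : (π : ℝ) ≠ 0 := Real.pi_ne_zero
  have h := Literature.Analysis.SpecialFunctions.hasSum_one_div_odd_sq.mul_left (8 / π ^ 2)
  rw [show 8 / π ^ 2 * (π ^ 2 / 8) = (1 : ℝ) by field_simp] at h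
  refine h.congr_fun fun m => ?_
  have hm : (2 * (m : ℝ) + 1) ≠ 0 := by positivity
  field_simp

/-! ## §4 The terms of `f_β` -/

section Weight

variable {β : ℝ}

/-- The `m`-th Matsubara rate `(2m+1)π/β` is positive. [folklore] -/
theorem qbpRate_pos (hβ : 0 < β) (m : ℕ) : 0 < (2 * (m : ℝ) + 1) * π / β := by positivity

/-- The rates increase: `π/β ≤ (2m+1)π/β`. [folklore] -/
theorem qbpRate_zero_le (hβ : 0 < β) (m : ℕ) : π / β ≤ (2 * (m : ℝ) + 1) * π / β := by
  rw [div_le_div_iff_of_pos_right hβ]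
  have hm : (0 : ℝ) ≤ m := m.cast_nonneg
  nlinarith [Real.pi_pos]

/-- The `m`-th term of `f_β` is nonnegative. [folklore] -/
theorem qbpTerm_nonneg (hβ : 0 < β) (m : ℕ) (t : ℝ) :
    0 ≤ 4 / (β * ((2 * (m : ℝ) + 1) * π)) * Real.exp (-((2 * (m : ℝ) + 1) * π / β * |t|)) := by
  have := hβ.le
  positivity

/-- The `m`-th term of `f_β` is integrable. [folklore] -/
theorem integrable_qbpTerm (hβ : 0 < β) (m : ℕ) :
    Integrable fun t : ℝ => 4 / (β * ((2 * (m : ℝ) + 1) * π)) * Real.exp (-((2 * (m : ℝ) + 1) * π / β * |t|)) :=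
  (integrable_exp_neg_mul_abs_real (qbpRate_pos hβ m)).const_mul _

/-- `∫ (m-th term) = 8/((2m+1)²π²)`. [folklore] -/
theorem integral_qbpTerm (hβ : 0 < β) (m : ℕ) :
    ∫ t : ℝ, 4 / (β * ((2 * (m : ℝ) + 1) * π)) * Real.exp (-((2 * (m : ℝ) + 1) * π / β * |t|)) =
      8 / ((2 * (m : ℝ) + 1) ^ 2 * π ^ 2) := by
  rw [integral_const_mul, integral_exp_neg_mul_abs_real (qbpRate_pos hβ m)]
  have hm : (2 * (m : ℝ) + 1) ≠ 0 := by positivity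
  have hπ : (π : ℝ) ≠ 0 := Real.pi_ne_zero
  field_simp
  ring

/-- `∫ ‖m-th term‖ = 8/((2m+1)²π²)`. [folklore] -/
theorem integral_norm_qbpTerm (hβ : 0 < β) (m : ℕ) :
    ∫ t : ℝ, ‖4 / (β * ((2 * (m : ℝ) + 1) * π)) * Real.exp (-((2 * (m : ℝ) + 1) * π / β * |t|))‖ =
      8 / ((2 * (m : ℝ) + 1) ^ 2 * π ^ 2) := by
  rw [← integral_qbpTerm hβ m]
  exact integral_congr_ae (Eventually.of_forall fun t => Real.norm_of_nonneg (qbpTerm_nonneg hβ m t))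

/-- The Fourier transform of the `m`-th term: `(4/(β(2m+1)π)) · 2aₘ/(aₘ² + ω²) = (8/β²)/(aₘ² + ω²)`.
[folklore] -/
theorem integral_cexp_mul_qbpTerm (hβ : 0 < β) (m : ℕ) (ω : ℝ) :
    ∫ t : ℝ, cexp ((t : ℂ) * (ω : ℂ) * I) *
        ((4 / (β * ((2 * (m : ℝ) + 1) * π)) * Real.exp (-((2 * (m : ℝ) + 1) * π / β * |t|)) : ℝ) : ℂ) =
      ((8 / β ^ 2 / (((2 * (m : ℝ) + 1) * π / β) ^ 2 + ω ^ 2) : ℝ) : ℂ) := by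
  have hc : ∀ t : ℝ, cexp ((t : ℂ) * (ω : ℂ) * I) *
      ((4 / (β * ((2 * (m : ℝ) + 1) * π)) * Real.exp (-((2 * (m : ℝ) + 1) * π / β * |t|)) : ℝ) : ℂ) =
      ((4 / (β * ((2 * (m : ℝ) + 1) * π)) : ℝ) : ℂ) *
        (cexp ((t : ℂ) * (ω : ℂ) * I) * (Real.exp (-((2 * (m : ℝ) + 1) * π / β * |t|)) : ℂ)) := by
    intro t
    push_cast
    ring
  simp_rw [hc]
  rw [integral_const_mul, integral_cexp_mul_exp_neg_mul_abs (qbpRate_pos hβ m) ω, ← Complex.ofReal_mul]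
  congr 1
  have hm : (2 * (m : ℝ) + 1) ≠ 0 := by positivity
  have hπ : (π : ℝ) ≠ 0 := Real.pi_ne_zero
  have hβ0 : β ≠ 0 := hβ.ne'
  have hden : ((2 * (m : ℝ) + 1) * π / β) ^ 2 + ω ^ 2 ≠ 0 := by
    have := qbpRate_pos hβ m
    positivity
  rw [div_div, eq_div_iff (mul_ne_zero (pow_ne_zero 2 hβ0) hden)]
  field_simp
  ring

/-- The exact tail of the `m`-th term: `∫_{|t| > T} = (8/((2m+1)²π²)) e^{-aₘ T}`. [folklore] -/
theorem setIntegral_qbpTerm_tail (hβ : 0 < β) (m : ℕ) {T : ℝ} (hT : 0 ≤ T) :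
    ∫ t in {t : ℝ | T < |t|}, 4 / (β * ((2 * (m : ℝ) + 1) * π)) * Real.exp (-((2 * (m : ℝ) + 1) * π / β * |t|)) =
      8 / ((2 * (m : ℝ) + 1) ^ 2 * π ^ 2) * Real.exp (-((2 * (m : ℝ) + 1) * π / β * T)) := by
  rw [integral_const_mul, setIntegral_exp_neg_mul_abs_tail (qbpRate_pos hβ m) hT]
  have hm : (2 * (m : ℝ) + 1) ≠ 0 := by positivity
  have hπ : (π : ℝ) ≠ 0 := Real.pi_ne_zero
  field_simp
  ring

/-! ## §5 The weight `f_β`: positivity, mass one, Fourier transform, kernel identity, tails -/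

variable {f : ℝ → ℝ}

/-- `f_β ≥ 0`. [cite: CapelEtAl2023, §2.2 (2.8)] -/
theorem qbpWeight_nonneg (hβ : 0 < β)
    (hf : ∀ t, f t = ∑' m : ℕ, 4 / (β * ((2 * (m : ℝ) + 1) * π)) * Real.exp (-((2 * (m : ℝ) + 1) * π / β * |t|)))
    (t : ℝ) : 0 ≤ f t := by
  rw [hf t]
  exact tsum_nonneg fun m => qbpTerm_nonneg hβ m t

/-- `f_β` is integrable. [cite: CapelEtAl2023, §2.2 (2.8)] -/
theorem integrable_qbpWeight (hβ : 0 < β)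
    (hf : ∀ t, f t = ∑' m : ℕ, 4 / (β * ((2 * (m : ℝ) + 1) * π)) * Real.exp (-((2 * (m : ℝ) + 1) * π / β * |t|))) :
    Integrable f := by
  rw [show f = fun t => ∑' m : ℕ, 4 / (β * ((2 * (m : ℝ) + 1) * π)) *
      Real.exp (-((2 * (m : ℝ) + 1) * π / β * |t|)) from funext hf]
  refine integrable_tsum_of_summable_integral_norm' (integrable_qbpTerm hβ) ?_
  simp_rw [integral_norm_qbpTerm hβ]
  exact hasSum_qbpMass.summable

/-- `∫ f_β = 1`. [cite: CapelEtAl2023, §2.2 (2.8)] -/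
theorem integral_qbpWeight (hβ : 0 < β)
    (hf : ∀ t, f t = ∑' m : ℕ, 4 / (β * ((2 * (m : ℝ) + 1) * π)) * Real.exp (-((2 * (m : ℝ) + 1) * π / β * |t|))) :
    ∫ t, f t = 1 := by
  simp_rw [hf]
  rw [← integral_tsum_of_summable_integral_norm (integrable_qbpTerm hβ)
    (by simp_rw [integral_norm_qbpTerm hβ]; exact hasSum_qbpMass.summable)]
  simp_rw [integral_qbpTerm hβ]
  exact hasSum_qbpMass.tsum_eq

/-- `∫ |f_β| = 1` (the `L¹` norm entering the QBP bounds of parts 2–3). [cite: CapelEtAl2023, §2.2 (2.8)] -/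
theorem integral_abs_qbpWeight (hβ : 0 < β)
    (hf : ∀ t, f t = ∑' m : ℕ, 4 / (β * ((2 * (m : ℝ) + 1) * π)) * Real.exp (-((2 * (m : ℝ) + 1) * π / β * |t|))) :
    ∫ t, |f t| = 1 := by
  rw [← integral_qbpWeight hβ hf]
  exact integral_congr_ae (Eventually.of_forall fun t => abs_of_nonneg (qbpWeight_nonneg hβ hf t))

/-- The Fourier transform of `f_β` as a Matsubara series:
`∫ e^{itω} f_β(t) dt = Σₘ (8/β²)/(aₘ² + ω²)`, `aₘ = (2m+1)π/β`. [cite: CapelEtAl2023, §2.2 (2.8)] -/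
theorem integral_cexp_mul_qbpWeight_eq_tsum (hβ : 0 < β)
    (hf : ∀ t, f t = ∑' m : ℕ, 4 / (β * ((2 * (m : ℝ) + 1) * π)) * Real.exp (-((2 * (m : ℝ) + 1) * π / β * |t|)))
    (ω : ℝ) :
    ∫ t : ℝ, cexp ((t : ℂ) * (ω : ℂ) * I) * (f t : ℂ) =
      ((∑' m : ℕ, 8 / β ^ 2 / (((2 * (m : ℝ) + 1) * π / β) ^ 2 + ω ^ 2) : ℝ) : ℂ) := by
  set F : ℕ → ℝ → ℂ := fun m t => cexp ((t : ℂ) * (ω : ℂ) * I) *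
    ((4 / (β * ((2 * (m : ℝ) + 1) * π)) * Real.exp (-((2 * (m : ℝ) + 1) * π / β * |t|)) : ℝ) : ℂ) with hF
  have hnormF : ∀ m t, ‖F m t‖ =
      4 / (β * ((2 * (m : ℝ) + 1) * π)) * Real.exp (-((2 * (m : ℝ) + 1) * π / β * |t|)) := by
    intro m t
    rw [hF]
    simp only
    rw [norm_mul, show (t : ℂ) * (ω : ℂ) * I = ((t * ω : ℝ) : ℂ) * I by push_cast; ring,
      Complex.norm_exp_ofReal_mul_I, one_mul, Complex.norm_real, Real.norm_of_nonneg (qbpTerm_nonneg hβ m t)]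
  have hFint : ∀ m, Integrable (F m) := by
    intro m
    refine (integrable_qbpTerm hβ m).ofReal.bdd_mul (c := 1)
      (Complex.continuous_exp.comp (by fun_prop)).aestronglyMeasurable (Eventually.of_forall fun t => ?_)
    rw [show (t : ℂ) * (ω : ℂ) * I = ((t * ω : ℝ) : ℂ) * I by push_cast; ring, Complex.norm_exp_ofReal_mul_I]
  have hFsum : Summable fun m => ∫ t, ‖F m t‖ := by
    simp_rw [hnormF, integral_qbpTerm hβ]
    exact hasSum_qbpMass.summable
  have hlhs : (fun t : ℝ => cexp ((t : ℂ) * (ω : ℂ) * I) * (f t : ℂ)) = fun t => ∑' m, F m t := by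
    funext t
    rw [hf t, Complex.ofReal_tsum, ← tsum_mul_left]
  rw [hlhs, ← integral_tsum_of_summable_integral_norm hFint hFsum, Complex.ofReal_tsum]
  exact tsum_congr fun m => integral_cexp_mul_qbpTerm hβ m ω

/-- The Fourier transform of `f_β` off zero: `∫ e^{itω} f_β(t) dt = 2 tanh(βω/2)/(βω) = tanh(βω/2)/(βω/2)`
(`ω ≠ 0`), by the fermionic Matsubara sum. [cite: CapelEtAl2023, §2.2 (2.8)] -/
theorem integral_cexp_mul_qbpWeight_of_ne_zero (hβ : 0 < β)
    (hf : ∀ t, f t = ∑' m : ℕ, 4 / (β * ((2 * (m : ℝ) + 1) * π)) * Real.exp (-((2 * (m : ℝ) + 1) * π / β * |t|)))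
    {ω : ℝ} (hω : ω ≠ 0) :
    ∫ t : ℝ, cexp ((t : ℂ) * (ω : ℂ) * I) * (f t : ℂ) =
      ((2 * Real.tanh (β * ω / 2) / (β * ω) : ℝ) : ℂ) := by
  rw [integral_cexp_mul_qbpWeight_eq_tsum hβ hf ω]
  congr 1
  simp_rw [div_eq_mul_one_div (8 / β ^ 2)]
  rw [tsum_mul_left, tsum_one_div_matsubara_sq_add_sq hβ hω]
  have hβ0 : β ≠ 0 := hβ.ne'
  field_simp
  ring

/-- The Fourier transform of `f_β` at zero: `∫ f_β = 1` in complex form. [cite: CapelEtAl2023, §2.2 (2.8)] -/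
theorem integral_cexp_mul_qbpWeight_zero (hβ : 0 < β)
    (hf : ∀ t, f t = ∑' m : ℕ, 4 / (β * ((2 * (m : ℝ) + 1) * π)) * Real.exp (-((2 * (m : ℝ) + 1) * π / β * |t|))) :
    ∫ t : ℝ, cexp ((t : ℂ) * ((0 : ℝ) : ℂ) * I) * (f t : ℂ) = 1 := by
  rw [integral_cexp_mul_qbpWeight_eq_tsum hβ hf 0]
  have hterm : ∀ m : ℕ, 8 / β ^ 2 / (((2 * (m : ℝ) + 1) * π / β) ^ 2 + (0 : ℝ) ^ 2) =
      8 / ((2 * (m : ℝ) + 1) ^ 2 * π ^ 2) := by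
    intro m
    have hm : (2 * (m : ℝ) + 1) ≠ 0 := by positivity
    have hπ : (π : ℝ) ≠ 0 := Real.pi_ne_zero
    have hβ0 : β ≠ 0 := hβ.ne'
    rw [sq (0 : ℝ), mul_zero, add_zero]
    field_simp
  rw [tsum_congr hterm, hasSum_qbpMass.tsum_eq]
  simp

/-- **The kernel identity of `f_β`** (the hypothesis `hfK` of part 3, `hasDerivAt_gibbsWeight_qbp`):
`f̂_β(y - x) · (e^{-βx} + e^{-βy}) = 2 K_β(x, y)` for all real `x, y`, i.e.
`tanh(β(y-x)/2)/(β(y-x)/2) · (e^{-βx} + e^{-βy}) = 2 (e^{-βx} - e^{-βy})/(β(y-x))`.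
[cite: CapelEtAl2023, Proposition 6 and §10.1.1 (10.1)–(10.3)] -/
theorem qbpWeight_kernel_identity (hβ : 0 < β)
    (hf : ∀ t, f t = ∑' m : ℕ, 4 / (β * ((2 * (m : ℝ) + 1) * π)) * Real.exp (-((2 * (m : ℝ) + 1) * π / β * |t|)))
    (x y : ℝ) :
    (∫ t : ℝ, cexp ((t : ℂ) * ((y : ℂ) - (x : ℂ)) * I) * (f t : ℂ)) *
        (((Real.exp (-(β * x)) + Real.exp (-(β * y)) : ℝ)) : ℂ) =
      2 * (Matrix.duhamelKernel β x y : ℂ) := by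
  rw [show (y : ℂ) - (x : ℂ) = ((y - x : ℝ) : ℂ) by push_cast; ring]
  rcases eq_or_ne x y with hxy | hxy
  · subst hxy
    rw [show ((x - x : ℝ)) = 0 by ring, integral_cexp_mul_qbpWeight_zero hβ hf, one_mul]
    have hK : Matrix.duhamelKernel β x x = Real.exp (-(β * x)) := by
      simp_rw [Matrix.duhamelKernel, show ∀ s : ℝ, s * x + (1 - s) * x = x from fun s => by ring]
      simp
    rw [hK]
    push_cast
    ring
  · have hω : y - x ≠ 0 := sub_ne_zero.2 (Ne.symm hxy)
    rw [integral_cexp_mul_qbpWeight_of_ne_zero hβ hf hω]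
    set u : ℝ := Real.exp (-(β * x)) with hu
    set v : ℝ := Real.exp (-(β * y)) with hv
    have hu0 : 0 < u := Real.exp_pos _
    have hv0 : 0 < v := Real.exp_pos _
    have hexp : Real.exp (β * (y - x)) = u / v := by
      rw [eq_div_iff hv0.ne', hu, hv, ← Real.exp_add]
      congr 1
      ring
    have hK : Matrix.duhamelKernel β x y = (u - v) / (β * (y - x)) := by
      rw [eq_div_iff (mul_ne_zero hβ.ne' hω)]
      have := Matrix.exp_sub_exp_eq_mul_duhamelKernel β x y
      rw [← hu, ← hv] at this
      linarith [this]
    have hreal : 2 * Real.tanh (β * (y - x) / 2) / (β * (y - x)) * (u + v) = 2 * ((u - v) / (β * (y - x))) := by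
      rw [tanh_half_eq, hexp]
      have huv : u / v + 1 ≠ 0 := by positivity
      field_simp
    rw [hK]
    exact_mod_cast hreal

/-- The tail bound `∫_{|t| > T} |f_β| ≤ e^{-πT/β}` (`T ≥ 0`): every rate is `≥ a₀ = π/β` and the total
mass is one. [cite: CapelEtAl2023, §2.2 (2.8), Lemma 7] -/
theorem setIntegral_abs_qbpWeight_tail_le (hβ : 0 < β)
    (hf : ∀ t, f t = ∑' m : ℕ, 4 / (β * ((2 * (m : ℝ) + 1) * π)) * Real.exp (-((2 * (m : ℝ) + 1) * π / β * |t|)))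
    {T : ℝ} (hT : 0 ≤ T) :
    ∫ t in {t : ℝ | T < |t|}, |f t| ≤ Real.exp (-(π / β * T)) := by
  have habs : ∫ t in {t : ℝ | T < |t|}, |f t| = ∫ t in {t : ℝ | T < |t|}, ∑' m : ℕ,
      4 / (β * ((2 * (m : ℝ) + 1) * π)) * Real.exp (-((2 * (m : ℝ) + 1) * π / β * |t|)) :=
    integral_congr_ae (Eventually.of_forall fun t => by
      simp only
      rw [abs_of_nonneg (qbpWeight_nonneg hβ hf t), hf t])
  have hsum : Summable fun m : ℕ => ∫ t in {t : ℝ | T < |t|},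
      ‖4 / (β * ((2 * (m : ℝ) + 1) * π)) * Real.exp (-((2 * (m : ℝ) + 1) * π / β * |t|))‖ := by
    refine Summable.of_nonneg_of_le (fun m => integral_nonneg fun t => norm_nonneg _) (fun m => ?_)
      (hasSum_qbpMass.summable.congr fun m => (integral_norm_qbpTerm hβ m).symm)
    exact setIntegral_le_integral (integrable_qbpTerm hβ m).norm (Eventually.of_forall fun t => norm_nonneg _)
  rw [habs, ← integral_tsum_of_summable_integral_norm (fun m => (integrable_qbpTerm hβ m).restrict) hsum]
  simp_rw [setIntegral_qbpTerm_tail hβ _ hT]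
  have hle : ∀ m : ℕ, 8 / ((2 * (m : ℝ) + 1) ^ 2 * π ^ 2) * Real.exp (-((2 * (m : ℝ) + 1) * π / β * T)) ≤
      8 / ((2 * (m : ℝ) + 1) ^ 2 * π ^ 2) * Real.exp (-(π / β * T)) := by
    intro m
    refine mul_le_mul_of_nonneg_left (Real.exp_le_exp.2 ?_) (by positivity)
    have := mul_le_mul_of_nonneg_right (qbpRate_zero_le hβ m) hT
    linarith
  have h1 : Summable fun m : ℕ => 8 / ((2 * (m : ℝ) + 1) ^ 2 * π ^ 2) * Real.exp (-(π / β * T)) :=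
    hasSum_qbpMass.summable.mul_right _
  have h0 : Summable fun m : ℕ =>
      8 / ((2 * (m : ℝ) + 1) ^ 2 * π ^ 2) * Real.exp (-((2 * (m : ℝ) + 1) * π / β * T)) :=
    Summable.of_nonneg_of_le (fun m => by positivity) hle h1
  calc ∑' m : ℕ, 8 / ((2 * (m : ℝ) + 1) ^ 2 * π ^ 2) * Real.exp (-((2 * (m : ℝ) + 1) * π / β * T))
      ≤ ∑' m : ℕ, 8 / ((2 * (m : ℝ) + 1) ^ 2 * π ^ 2) * Real.exp (-(π / β * T)) := h0.tsum_le_tsum hle h1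
    _ = Real.exp (-(π / β * T)) := by rw [tsum_mul_right, hasSum_qbpMass.tsum_eq, one_mul]

end Weight

end Summit.Ventures.CertifiedManyBodySolver.Theorems.TcThermcert1.GaugeQbpFarSeam
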